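import Literature.NumberTheory.Automorphic.CMPrincipalSeriesHTraceOrbitalForm   -- ★ p843… (B-p18) `smoothTrace_cmPrincipalSeriesH_eq_inv_mul_integral` (Rogawski (4.9.4) on `H_v`, canonical orbital integrals)
import Literature.MeasureTheory.Group.CharacterIntegralsTwoCosetInversion       -- ★ LH2-p03 (g3) generic «TWO-COSET FOURIER INVERSION» `eq_twoCoset_of_forall_integral_char_mul_eq`
import Literature.NumberTheory.Automorphic.LocalEndoscopicOrbitClosed             -- ★ `gl_fin_one_comm` (`U(Φ₁)_v ≤ GL₁` is commutative)
import HarnessLib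

/-!
# F0 · P3c · line LH6 «StCharTS» — road (D) «DEEP-FL», brick D3-ii-H «SHELL-ORBITAL — H TWIN»: the normalised canonical split-torus orbital integrals on
# `H_v = U(Φ₂)(L⁺_v) × U(Φ₁)(L⁺_v)` FROM their spectral (principal-series) data — a two-coset step function on `T_H = T₂ × U(Φ₁)_v`, constant explicit

Cell `pub/hodgecm-mathlib`, crux H413 = `stmt-HodgeConjecture-24833` (`--supports` lane, helper), route HCCMUnconditional; seat LH7-p04 (g2), dealt by the LH6 desk
F0P3b-plan (g23) 2026-09-02T05:18:06Z («H twin» of LH2-p03 (g3)'s `Theorems/F0P3cStCharTSShellOrbitalG`); road owner LH6-p04 (g2), spec of record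
`F0/P3b/LH6-p04/g2/ROAD-D.status.v3.txt` § «D3-ii SHELL-ORBITAL-G∕H» + interface v2 e7201338631be5de.  THEOREMS ONLY (★-only imports; no definition ∕ instance ∕
notation ∕ named fact ∕ `sorry`).  HONEST LABEL: road-(D) brick, count-neutral — nothing here closes (S-X) `stub_StXIGSt`; HC_CM is proved only modulo the 7 printed
citations (2 remaining: hLiu418 = stmt-HodgeConjecture-24832, h413 = stmt-HodgeConjecture-24833) until rung 0 closes.

THE MATHEMATICS ([Rogawski1990, §4.9 Lemma 4.9.2 ∕ (4.9.4) p. 56 for `H`; §12.1 p. 171; L. 12.7.3 proof p. 195]; [vanDijk1972]; [HewittRoss1979, (23.11)]).  By ★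
`smoothTrace_cmPrincipalSeriesH_eq_inv_mul_integral`, for every character `χ₂` of the diagonal torus `T₂` of `U(Φ₂)_v` (continuous) and `χ₁` of `U(Φ₁)_v` (open kernel)
and every test function `f_H`,
  `tr i_H(χ₂ ⊠ χ₁)(f_H; ν_H) = c · ∫_{T₂} ∫_{U(Φ₁)} χ₂(t) χ₁(u) Ψ(t, u) dν₁ dμ_T`,   `c = (μ_T(T₂ ∩ K_{2,v}) · ν₁(U(Φ₁)_v))⁻¹`,
where `Ψ(t, u) = δ_{B₂}^{1∕2}(t) · J₂(t)⁻¹ · O^{can}_{(t,u)}(f_H)` is the NORMALISED canonical orbital integral (a.e.; `J₂(t) = χ⁻(d₀⁻¹d₁)⁻¹` the torus module).  If the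
spectral side is KNOWN in the two-coset closed form of the shell computation (F1-H, hypothesis `hF1H` BY SHAPE — LH5-p05 (g2)'s (D-b) ∕ BRICK 2 output):
  `tr i_H(χ₂ ⊠ χ₁)(f_H) = A · [χ₂|_{C₂} = 1] · [χ₁|_{K₁} = 1] · χ₁(z₁) · (χ₂(b₁) + κ χ₂(b₂))`,
then, reading `(χ₂, χ₁)` as ONE character `χ` of the abelian group `T_H = T₂ × U(Φ₁)_v` and the iterated integral as the product-Haar integral (Fubini), the
character integrals of `Ψ` are `(A∕c) · [χ|_{C₂ × K₁} = 1] · (χ(b₁, z₁) + κ χ(b₂, z₁))`, and ★ `eq_twoCoset_of_forall_integral_char_mul_eq` (LH2-p03 (g3); Hewitt–Ross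
(23.11) on `T_H ⧸ C′`) (`…_of_comm` form) inverts:
  `Ψ = (A ∕ (c · μ_T(C₂) · ν₁(K₁))) · (𝟙_{(b₁,z₁)·(C₂×K₁)} + κ · 𝟙_{(b₂,z₁)·(C₂×K₁)})`   EVERYWHERE on `T_H`
— i.e. «`O^{can}_{(t,u)}(f_H) = J₂(t) · δ_{B₂}^{-1∕2}(t) · κ_H · (𝟙_{b₁C₂}(t) + κ·𝟙_{b₂C₂}(t)) · 𝟙_{z₁K₁}(u)`», `κ_H = A · μ_T(T₂ ∩ K_{2,v}) · ν₁(U(Φ₁)_v) ∕ (μ_T(C₂) · ν₁(K₁))`.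
In the road's application `f_H = 𝟙_{K_H b_H K_H} = 𝟙_{K₂ b₂ K₂} ⊗ 𝟙_{z₁K₁}` (`K₂ = 𝓘₂.K n₂` Iwahori-factorised, `C₂ = T₂ ∩ K₂`, `b₁ = b₂` of interface §1(b), `b₂ = b₂ʷ`), and the
locally constant compactly supported VERSION `Ψ` of the normalised orbital integral (hypothesis `hΨ` BY SHAPE) is produced by LH2-p03's generic glue (local constancy on
`T_H^{reg}` + compact support) — named inputs, not restated here.

* §1 `map_prod_eq_mul_inl_inr` (a character of a product splits), `forall_mem_prod_eq_one_iff` (triviality on `C₂ × K₁` ↔ on `C₂` and on `K₁`),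
  `exists_isOpen_subgroup_subset_of_nonarchimedean_prod_subtype` (open subgroups are a basis at `1` in `T₂ × U(Φ₁)_v`: ★ `nonarchimedeanGroup_cmLocal`).
* §2 **`normalizedOrbitalIntegralH_eq_twoCoset`** (the H twin of D3-ii) and its pointwise reading `classOrbitalIntegralH_eq_twoCoset_apply`.

## References
* [Rogawski1990] J. D. Rogawski, *Automorphic Representations of Unitary Groups in Three Variables*, Ann. of Math. Stud. 123 (1990), §4.9 (4.9.4) p. 56; §12.1 p. 171;
  §12.7 Lemma 12.7.3 (proof) p. 195.
* [vanDijk1972] G. van Dijk, *Computation of certain induced characters of p-adic groups*, Math. Ann. 199 (1972), Thm. p. 237.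
* [HewittRoss1979] E. Hewitt, K. A. Ross, *Abstract Harmonic Analysis I*, 2nd ed. (1979), Thm. (23.11).
-/

set_option autoImplicit false
-- the mandated namespace has the single-problem summit's repeated segment (`HodgeConjecture.HodgeConjecture`)
set_option linter.dupNamespace false

noncomputable section

open NumberField IsDedekindDomain MeasureTheory MeasureTheory.Measure Topology Filter
open Literature.MeasureTheory.Group
open Literature.NumberTheory.Automorphic Literature.NumberTheory.Automorphic.UnitaryGroup
open Literature.NumberTheory.Automorphic.UnitaryGroup.HeisRing Literature.NumberTheory.Automorphic.UnitaryGroup.LineRing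
open Literature.NumberTheory.Rogawski1990 (IsRegularElt)
open scoped Matrix MatrixGroups NNReal ENNReal Classical

namespace Summit.HodgeConjecture.HodgeConjecture.Cruxes.H413.F0P3cStCharTSShellOrbitalH

/-! ## §1 Generic glue: characters of a product; triviality on a product subgroup; an open-subgroup basis in `T₂ × U(Φ₁)_v` -/

/-- A character of a product is the product of its two restrictions: `χ(t, u) = χ(t, 1) · χ(1, u)`. [cite: HewittRoss1979, Thm. (23.18)] -/
theorem map_prod_eq_mul_inl_inr {M N : Type*} [Monoid M] [Monoid N] {A : Type*} [CommMonoid A] (χ : M × N →* A) (t : M) (u : N) :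
    χ (t, u) = χ.comp (MonoidHom.inl M N) t * χ.comp (MonoidHom.inr M N) u := by
  rw [MonoidHom.comp_apply, MonoidHom.comp_apply, MonoidHom.inl_apply, MonoidHom.inr_apply, ← map_mul, Prod.mk_mul_mk, mul_one, one_mul]

/-- Triviality of a character on a product subgroup `C₂ × K₁` is triviality of its restrictions on `C₂` and on `K₁`. [cite: HewittRoss1979, Thm. (23.18)] -/
theorem forall_mem_prod_eq_one_iff {M N : Type*} [Group M] [Group N] {A : Type*} [CommMonoid A] (χ : M × N →* A)
    (C₂ : Subgroup M) (K₁ : Subgroup N) :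
    (∀ c ∈ C₂.prod K₁, χ c = 1) ↔ (∀ c ∈ C₂, χ.comp (MonoidHom.inl M N) c = 1) ∧ (∀ k ∈ K₁, χ.comp (MonoidHom.inr M N) k = 1) := by
  constructor
  · intro h
    refine ⟨fun c hc => ?_, fun k hk => ?_⟩
    · rw [MonoidHom.comp_apply, MonoidHom.inl_apply]
      exact h (c, 1) (Subgroup.mem_prod.2 ⟨hc, K₁.one_mem⟩)
    · rw [MonoidHom.comp_apply, MonoidHom.inr_apply]
      exact h (1, k) (Subgroup.mem_prod.2 ⟨C₂.one_mem, hk⟩)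
  · rintro ⟨h₂, h₁⟩ ⟨t, u⟩ htu
    rw [map_prod_eq_mul_inl_inr χ t u, h₂ t (Subgroup.mem_prod.1 htu).1, h₁ u (Subgroup.mem_prod.1 htu).2, mul_one]

/-- In the product of a subgroup of a nonarchimedean group with a nonarchimedean group, the open subgroups form a neighbourhood basis of `1`.
[cite: HewittRoss1979, Thm. (7.7)] -/
theorem exists_isOpen_subgroup_subset_of_nonarchimedean_prod_subtype {G N : Type*} [Group G] [TopologicalSpace G] [NonarchimedeanGroup G]
    [Group N] [TopologicalSpace N] [NonarchimedeanGroup N] (S : Subgroup G) :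
    ∀ V ∈ 𝓝 (1 : ↥S × N), ∃ C' : Subgroup (↥S × N), IsOpen (C' : Set (↥S × N)) ∧ (C' : Set (↥S × N)) ⊆ V := by
  intro V hV
  obtain ⟨V₂, hV₂, V₁, hV₁, hsub⟩ := mem_nhds_prod_iff.1 hV
  obtain ⟨W₂, hW₂, hW₂V⟩ := (mem_nhds_subtype _ _ _).1 hV₂
  rw [OneMemClass.coe_one] at hW₂
  obtain ⟨O₂, hO₂⟩ := NonarchimedeanGroup.is_nonarchimedean W₂ hW₂
  obtain ⟨O₁, hO₁⟩ := NonarchimedeanGroup.is_nonarchimedean V₁ hV₁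
  refine ⟨((O₂ : Subgroup G).comap S.subtype).prod (O₁ : Subgroup N), ?_, ?_⟩
  · rw [Subgroup.coe_prod]
    exact (O₂.isOpen.preimage continuous_subtype_val).prod O₁.isOpen
  · rw [Subgroup.coe_prod]
    rintro ⟨s, n⟩ ⟨hs, hn⟩
    exact hsub ⟨hW₂V (hO₂ hs), hO₁ hn⟩

/-! ## §2 The H-side inversion: normalised canonical orbital integrals on `T_H` from the spectral data -/

section CM

variable (L : Type) [Field L] [NumberField L] [IsCMField L]

set_option maxHeartbeats 3200000 in
set_option synthInstance.maxHeartbeats 400000 in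
/-- **D3-ii-H «SHELL-ORBITAL — H TWIN» (spectral inversion of the H-side torus form).**  Frame = ★ `smoothTrace_cmPrincipalSeriesH_eq_inv_mul_integral` verbatim
(`v` non-split, any Borel structure and Haar measure `ν_H` on `H_v = U(Φ₂)_v × U(Φ₁)_v` with canonical orbital measures `m_H` (predicate `P_H`), Haar measures `μ_T` on
`T₂`, `ν₁` on `U(Φ₁)_v`, `U(Φ₁)_v ⊆ K_{1,v}`, a locally constant compactly supported `f_H`, regularity ∕ `P_H`-goodness a.e. (`hae`)); shell data `C₂ ≤ T₂` and
`K₁ ≤ U(Φ₁)_v` compact open, `b₁ b₂ ∈ T₂`, `z₁ ∈ U(Φ₁)_v`, `A κ ∈ ℂ`.  HYPOTHESES BY SHAPE: `hF1H` — the spectral side in two-coset closed form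
`tr i_H(χ₂ ⊠ χ₁)(f_H; ν_H) = [χ₂|_{C₂} = 1 ∧ χ₁|_{K₁} = 1] · A · χ₁(z₁) · (χ₂(b₁) + κ χ₂(b₂))` for every continuous `χ₂` and open-kernel `χ₁`; `hΨ` — a locally constant
compactly supported `Ψ : T₂ × U(Φ₁)_v → ℂ` equal, for `μ_T`-a.e. `t` and `ν₁`-a.e. `u`, at every diagonal writing `t = diag(d)` with `d₀⁻¹d₁ − 1` a unit, `t` regular and
`(t, u)` `P_H`-good, to `δ_{B₂}^{1∕2}(t) · J₂(t)⁻¹ · classOrbitalIntegral m_H f_H ⟦(t, u)⟧`.  CONCLUSION, everywhere on `T₂ × U(Φ₁)_v`: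
`Ψ = (A · μ_T{t ∈ K_{2,v}} · ν₁(univ) ∕ (μ_T(C₂) · ν₁(K₁))) · (𝟙_{(b₁,z₁)(C₂×K₁)} + κ · 𝟙_{(b₂,z₁)(C₂×K₁)})`.
[cite: Rogawski1990, §4.9 (4.9.4) p. 56; §12.1 p. 171; §12.7 Lemma 12.7.3 (proof) p. 195] [cite: vanDijk1972, Thm. p. 237] [cite: HewittRoss1979, Thm. (23.11)] -/
theorem normalizedOrbitalIntegralH_eq_twoCoset
    {v : HeightOneSpectrum (𝓞 ↥(maximalRealSubfield L))} (w : PlacesOver L v) (hw : IsCMField.complexConj L • w.1 = w.1)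
    [mHH : MeasurableSpace (((cmDatum L 2 (Matrix.of fun i j : Fin 2 => if i.val + j.val + 1 = 2 then (1 : L) else 0)).Local v) × ((cmDatum L 1 (Matrix.of fun i j : Fin 1 => if i.val + j.val + 1 = 1 then (1 : L) else 0)).Local v))] [BorelSpace (((cmDatum L 2 (Matrix.of fun i j : Fin 2 => if i.val + j.val + 1 = 2 then (1 : L) else 0)).Local v) × ((cmDatum L 1 (Matrix.of fun i j : Fin 1 => if i.val + j.val + 1 = 1 then (1 : L) else 0)).Local v))]
    [∀ a : (((cmDatum L 2 (Matrix.of fun i j : Fin 2 => if i.val + j.val + 1 = 2 then (1 : L) else 0)).Local v) × ((cmDatum L 1 (Matrix.of fun i j : Fin 1 => if i.val + j.val + 1 = 1 then (1 : L) else 0)).Local v)), MeasurableSpace ((((cmDatum L 2 (Matrix.of fun i j : Fin 2 => if i.val + j.val + 1 = 2 then (1 : L) else 0)).Local v) × ((cmDatum L 1 (Matrix.of fun i j : Fin 1 => if i.val + j.val + 1 = 1 then (1 : L) else 0)).Local v)) ⧸ Subgroup.centralizer ({a} : Set (((cmDatum L 2 (Matrix.of fun i j : Fin 2 => if i.val +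 j.val + 1 = 2 then (1 : L) else 0)).Local v) × ((cmDatum L 1 (Matrix.of fun i j : Fin 1 => if i.val + j.val + 1 = 1 then (1 : L) else 0)).Local v))))]
    [∀ a : (((cmDatum L 2 (Matrix.of fun i j : Fin 2 => if i.val + j.val + 1 = 2 then (1 : L) else 0)).Local v) × ((cmDatum L 1 (Matrix.of fun i j : Fin 1 => if i.val + j.val + 1 = 1 then (1 : L) else 0)).Local v)), BorelSpace ((((cmDatum L 2 (Matrix.of fun i j : Fin 2 => if i.val + j.val + 1 = 2 then (1 : L) else 0)).Local v) × ((cmDatum L 1 (Matrix.of fun i j : Fin 1 => if i.val + j.val + 1 = 1 then (1 : L) else 0)).Local v)) ⧸ Subgroup.centralizer ({a} : Set (((cmDatum L 2 (Matrix.of fun i j : Fin 2 => if i.val + j.val + 1 = 2 then (1 : L) else 0)).Local v) × ((cmDatum L 1 (Matrix.of fun i j : Fin 1 => if i.val + j.val + 1 = 1 then (1 : L) else 0)).Local v))))]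
    (νH : Measure (((cmDatum L 2 (Matrix.of fun i j : Fin 2 => if i.val + j.val + 1 = 2 then (1 : L) else 0)).Local v) × ((cmDatum L 1 (Matrix.of fun i j : Fin 1 => if i.val + j.val + 1 = 1 then (1 : L) else 0)).Local v))) [νH.IsHaarMeasure] [νH.IsMulRightInvariant]
    {P_H : (((cmDatum L 2 (Matrix.of fun i j : Fin 2 => if i.val + j.val + 1 = 2 then (1 : L) else 0)).Local v) × ((cmDatum L 1 (Matrix.of fun i j : Fin 1 => if i.val + j.val + 1 = 1 then (1 : L) else 0)).Local v)) → Prop} {mH : OrbitalMeasureFamily (((cmDatum L 2 (Matrix.of fun i j : Fin 2 => if i.val + j.val + 1 = 2 then (1 : L) else 0)).Local v) × ((cmDatum L 1 (Matrix.of fun i j : Fin 1 => if i.val + j.val + 1 = 1 then (1 : L) else 0)).Local v))} (hmH : mH.IsCanonical P_H νH)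
    [MeasurableSpace ↥(unitaryGroupOfForm (conjLocal L (IsCMField.complexConj L) v) (cmLocalForm L 2 v))] [BorelSpace ↥(unitaryGroupOfForm (conjLocal L (IsCMField.complexConj L) v) (cmLocalForm L 2 v))] [MeasurableSpace ((cmDatum L 1 (Matrix.of fun i j : Fin 1 => if i.val + j.val + 1 = 1 then (1 : L) else 0)).Local v)] [BorelSpace ((cmDatum L 1 (Matrix.of fun i j : Fin 1 => if i.val + j.val + 1 = 1 then (1 : L) else 0)).Local v)]
    (μT : Measure ↥(cmBorelTriple L 2 v).M) [μT.IsHaarMeasure] (ν₁ : Measure ((cmDatum L 1 (Matrix.of fun i j : Fin 1 => if i.val + j.val + 1 = 1 then (1 : L) else 0)).Local v)) [ν₁.IsHaarMeasure]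
    (hK₁ : ∀ x : ((cmDatum L 1 (Matrix.of fun i j : Fin 1 => if i.val + j.val + 1 = 1 then (1 : L) else 0)).Local v), x ∈ cmLocalIntegralLevel L 1 (Matrix.of fun i j : Fin 1 => if i.val + j.val + 1 = 1 then (1 : L) else 0) v)
    (fH : (((cmDatum L 2 (Matrix.of fun i j : Fin 2 => if i.val + j.val + 1 = 2 then (1 : L) else 0)).Local v) × ((cmDatum L 1 (Matrix.of fun i j : Fin 1 => if i.val + j.val + 1 = 1 then (1 : L) else 0)).Local v)) → ℂ) (hfH : IsLocallyConstant fH) (hfHc : HasCompactSupport fH)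
    (hae : ∀ᵐ t : ↥(cmBorelTriple L 2 v).M ∂μT, ∀ᵐ u : ((cmDatum L 1 (Matrix.of fun i j : Fin 1 => if i.val + j.val + 1 = 1 then (1 : L) else 0)).Local v) ∂ν₁,
      IsRegularElt ((t : ↥(unitaryGroupOfForm (conjLocal L (IsCMField.complexConj L) v) (cmLocalForm L 2 v))) : GL (Fin 2) (LocalRing L v)) ∧ P_H (Quotient.out (ConjClasses.mk (((t : ↥(unitaryGroupOfForm (conjLocal L (IsCMField.complexConj L) v) (cmLocalForm L 2 v))) : ((cmDatum L 2 (Matrix.of fun i j : Fin 2 => if i.val + j.val + 1 = 2 then (1 : L) else 0)).Local v)), u))))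
    (C₂ : Subgroup ↥(cmBorelTriple L 2 v).M) (hC₂o : IsOpen (C₂ : Set ↥(cmBorelTriple L 2 v).M)) (hC₂c : IsCompact (C₂ : Set ↥(cmBorelTriple L 2 v).M))
    (K₁ : Subgroup ((cmDatum L 1 (Matrix.of fun i j : Fin 1 => if i.val + j.val + 1 = 1 then (1 : L) else 0)).Local v)) (hK₁o : IsOpen (K₁ : Set ((cmDatum L 1 (Matrix.of fun i j : Fin 1 => if i.val + j.val + 1 = 1 then (1 : L) else 0)).Local v))) (hK₁c : IsCompact (K₁ : Set ((cmDatum L 1 (Matrix.of fun i j : Fin 1 => if i.val + j.val + 1 = 1 then (1 : L) else 0)).Local v)))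
    (b₁ b₂ : ↥(cmBorelTriple L 2 v).M) (z₁ : ((cmDatum L 1 (Matrix.of fun i j : Fin 1 => if i.val + j.val + 1 = 1 then (1 : L) else 0)).Local v)) (A κ : ℂ)
    (hF1H : haveI := locallyCompactSpace_cmBorelU L 2 v
      ∀ (χ₂ : ↥(torusU (conjLocal L (IsCMField.complexConj L) v) (cmLocalForm L 2 v)) →* ℂˣ) (_hχ₂ : Continuous fun t => ((χ₂ t : ℂˣ) : ℂ))
        (χ₁ : ((cmDatum L 1 (Matrix.of fun i j : Fin 1 => if i.val + j.val + 1 = 1 then (1 : L) else 0)).Local v) →* ℂˣ) (_hχ₁ : IsOpen ((χ₁.ker : Subgroup ((cmDatum L 1 (Matrix.of fun i j : Fin 1 => if i.val + j.val + 1 = 1 then (1 : L) else 0)).Local v)) : Set ((cmDatum L 1 (Matrix.of fun i j : Fin 1 => if i.val + j.val + 1 = 1 then (1 : L) else 0)).Local v))),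
        (cmPrincipalSeriesH L v χ₂ χ₁).smoothTrace νH fH =
          if (∀ c ∈ C₂, χ₂ c = 1) ∧ (∀ k ∈ K₁, χ₁ k = 1)
          then A * ((χ₁ z₁ : ℂˣ) : ℂ) * (((χ₂ b₁ : ℂˣ) : ℂ) + κ * ((χ₂ b₂ : ℂˣ) : ℂ)) else 0)
    (Ψ : ↥(cmBorelTriple L 2 v).M × ((cmDatum L 1 (Matrix.of fun i j : Fin 1 => if i.val + j.val + 1 = 1 then (1 : L) else 0)).Local v) → ℂ) (hΨlc : IsLocallyConstant Ψ) (hΨK : HasCompactSupport Ψ)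
    (hΨ : haveI := locallyCompactSpace_cmBorelU L 2 v
      ∀ᵐ t : ↥(cmBorelTriple L 2 v).M ∂μT, ∀ᵐ u : ((cmDatum L 1 (Matrix.of fun i j : Fin 1 => if i.val + j.val + 1 = 1 then (1 : L) else 0)).Local v) ∂ν₁, ∀ (d : Fin 2 → (LocalRing L v)ˣ)
      (hd : glDiagonal 2 (LocalRing L v) d = ((t : ↥(unitaryGroupOfForm (conjLocal L (IsCMField.complexConj L) v) (cmLocalForm L 2 v))) : GL (Fin 2) (LocalRing L v)))
      (hb : IsUnit ((((d 0)⁻¹ * d 1 : (LocalRing L v)ˣ) : LocalRing L v) - 1)),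
      IsRegularElt ((t : ↥(unitaryGroupOfForm (conjLocal L (IsCMField.complexConj L) v) (cmLocalForm L 2 v))) : GL (Fin 2) (LocalRing L v)) → P_H (Quotient.out (ConjClasses.mk (((t : ↥(unitaryGroupOfForm (conjLocal L (IsCMField.complexConj L) v) (cmLocalForm L 2 v))) : ((cmDatum L 2 (Matrix.of fun i j : Fin 2 => if i.val + j.val + 1 = 2 then (1 : L) else 0)).Local v)), u))) →
      Ψ (t, u) =
          ((rootDeltaChar (cmBorelTriple L 2 v).P ⟨(t : ↥(unitaryGroupOfForm (conjLocal L (IsCMField.complexConj L) v) (cmLocalForm L 2 v))), (cmBorelTriple L 2 v).M_le t.2⟩ : ℂˣ) : ℂ) *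
        ((((letI : MeasurableSpace (LocalRing L v) := borel _; haveI : BorelSpace (LocalRing L v) := ⟨rfl⟩
          haveI : SecondCountableTopology (LocalRing L v) := secondCountableTopology_localRing (E := L) v
          ((skewModulus (conjLocal L (IsCMField.complexConj L) v) (continuous_conjLocal L (IsCMField.complexConj L) v) hb.unit
            (map_unit_torusScalar_sub_one_two (conjLocal L (IsCMField.complexConj L) v) (cmLocalForm_eq_over L 2 v)
              (⟨(t : ↥(unitaryGroupOfForm (conjLocal L (IsCMField.complexConj L) v) (cmLocalForm L 2 v))), t.2⟩ : ↥(torusU (conjLocal L (IsCMField.complexConj L) v) (cmLocalForm L 2 v))) hd hb))⁻¹ : ℝ≥0)) : ℝ) : ℂ))⁻¹ *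
        classOrbitalIntegral mH fH (ConjClasses.mk (((t : ↥(unitaryGroupOfForm (conjLocal L (IsCMField.complexConj L) v) (cmLocalForm L 2 v))) : ((cmDatum L 2 (Matrix.of fun i j : Fin 2 => if i.val + j.val + 1 = 2 then (1 : L) else 0)).Local v)), u))) :
    Ψ = fun x => (A * ((μT.real {t : ↥(cmBorelTriple L 2 v).M | (t : ↥(unitaryGroupOfForm (conjLocal L (IsCMField.complexConj L) v) (cmLocalForm L 2 v))) ∈ cmLocalIntegralLevel L 2 (Matrix.of fun i j : Fin 2 => if i.val + j.val + 1 = 2 then (1 : L) else 0) v} * ν₁.real Set.univ : ℝ) : ℂ)) /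
        ((μT.real (C₂ : Set ↥(cmBorelTriple L 2 v).M) * ν₁.real (K₁ : Set ((cmDatum L 1 (Matrix.of fun i j : Fin 1 => if i.val + j.val + 1 = 1 then (1 : L) else 0)).Local v)) : ℝ) : ℂ) *
      ({x : ↥(cmBorelTriple L 2 v).M × ((cmDatum L 1 (Matrix.of fun i j : Fin 1 => if i.val + j.val + 1 = 1 then (1 : L) else 0)).Local v) | (b₁, z₁)⁻¹ * x ∈ ((C₂.prod K₁ : Subgroup (↥(cmBorelTriple L 2 v).M × ((cmDatum L 1 (Matrix.of fun i j : Fin 1 => if i.val + j.val + 1 = 1 then (1 : L) else 0)).Local v))) : Set (↥(cmBorelTriple L 2 v).M × ((cmDatum L 1 (Matrix.of fun i j : Fin 1 => if i.val + j.val + 1 = 1 then (1 : L) else 0)).Local v)))}.indicator (fun _ => (1 : ℂ)) x +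
        κ * {x : ↥(cmBorelTriple L 2 v).M × ((cmDatum L 1 (Matrix.of fun i j : Fin 1 => if i.val + j.val + 1 = 1 then (1 : L) else 0)).Local v) | (b₂, z₁)⁻¹ * x ∈ ((C₂.prod K₁ : Subgroup (↥(cmBorelTriple L 2 v).M × ((cmDatum L 1 (Matrix.of fun i j : Fin 1 => if i.val + j.val + 1 = 1 then (1 : L) else 0)).Local v))) : Set (↥(cmBorelTriple L 2 v).M × ((cmDatum L 1 (Matrix.of fun i j : Fin 1 => if i.val + j.val + 1 = 1 then (1 : L) else 0)).Local v)))}.indicator (fun _ => (1 : ℂ)) x) := by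
  haveI := locallyCompactSpace_cmBorelU L 2 v
  -- topological ∕ measurable bookkeeping on the factors (both spellings)
  letI : MeasurableSpace ((cmDatum L 2 (Matrix.of fun i j : Fin 2 => if i.val + j.val + 1 = 2 then (1 : L) else 0)).Local v) := ‹MeasurableSpace ↥(unitaryGroupOfForm (conjLocal L (IsCMField.complexConj L) v) (cmLocalForm L 2 v))›
  haveI : BorelSpace ((cmDatum L 2 (Matrix.of fun i j : Fin 2 => if i.val + j.val + 1 = 2 then (1 : L) else 0)).Local v) := ‹BorelSpace ↥(unitaryGroupOfForm (conjLocal L (IsCMField.complexConj L) v) (cmLocalForm L 2 v))›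
  haveI : LocallyCompactSpace ↥(unitaryGroupOfForm (conjLocal L (IsCMField.complexConj L) v) (cmLocalForm L 2 v)) := locallyCompactSpace_local (IsCMField.complexConj L) 2 _ v
  haveI : SecondCountableTopology ↥(unitaryGroupOfForm (conjLocal L (IsCMField.complexConj L) v) (cmLocalForm L 2 v)) := secondCountableTopology_local (IsCMField.complexConj L) 2 _ v
  haveI : T2Space ↥(unitaryGroupOfForm (conjLocal L (IsCMField.complexConj L) v) (cmLocalForm L 2 v)) := t2Space_cmDatum_local 2 L (Matrix.of fun i j : Fin 2 => if i.val + j.val + 1 = 2 then (1 : L) else 0) v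
  haveI : NonarchimedeanGroup ↥(unitaryGroupOfForm (conjLocal L (IsCMField.complexConj L) v) (cmLocalForm L 2 v)) := nonarchimedeanGroup_cmLocal L 2 v
  haveI : LocallyCompactSpace ((cmDatum L 1 (Matrix.of fun i j : Fin 1 => if i.val + j.val + 1 = 1 then (1 : L) else 0)).Local v) := locallyCompactSpace_local (IsCMField.complexConj L) 1 _ v
  haveI : SecondCountableTopology ((cmDatum L 1 (Matrix.of fun i j : Fin 1 => if i.val + j.val + 1 = 1 then (1 : L) else 0)).Local v) := secondCountableTopology_local (IsCMField.complexConj L) 1 _ v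
  haveI : T2Space ((cmDatum L 1 (Matrix.of fun i j : Fin 1 => if i.val + j.val + 1 = 1 then (1 : L) else 0)).Local v) := t2Space_cmDatum_local 1 L (Matrix.of fun i j : Fin 1 => if i.val + j.val + 1 = 1 then (1 : L) else 0) v
  haveI : NonarchimedeanGroup ((cmDatum L 1 (Matrix.of fun i j : Fin 1 => if i.val + j.val + 1 = 1 then (1 : L) else 0)).Local v) := nonarchimedeanGroup_cmLocal L 1 v
  haveI : T1Space (LocalRing L v) := inferInstance
  -- the torus `T₂`: closed subgroup ⇒ locally compact, second countable, σ-compact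
  have hTcl := isClosed_torusU_of_t1Space (conjLocal L (IsCMField.complexConj L) v) (cmLocalForm L 2 v)
  haveI : LocallyCompactSpace ↥(cmBorelTriple L 2 v).M := hTcl.isClosedEmbedding_subtypeVal.locallyCompactSpace
  haveI : SecondCountableTopology ↥(cmBorelTriple L 2 v).M := TopologicalSpace.Subtype.secondCountableTopology _
  haveI : SigmaCompactSpace ↥(cmBorelTriple L 2 v).M := sigmaCompactSpace_of_locallyCompact_secondCountable
  haveI : SigmaCompactSpace ((cmDatum L 1 (Matrix.of fun i j : Fin 1 => if i.val + j.val + 1 = 1 then (1 : L) else 0)).Local v) := sigmaCompactSpace_of_locallyCompact_secondCountable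
  haveI : SigmaFinite μT := inferInstance
  haveI : SigmaFinite ν₁ := inferInstance
  haveI : (μT.prod ν₁).IsHaarMeasure := inferInstance
  -- the torus `T_H = T₂ × U(Φ₁)_v` is abelian (★ `mul_comm_of_mem_torusU_cmLocal_two`, ★ `gl_fin_one_comm`; no instance declared)
  have hcomm : ∀ x y : ↥(cmBorelTriple L 2 v).M × ((cmDatum L 1 (Matrix.of fun i j : Fin 1 => if i.val + j.val + 1 = 1 then (1 : L) else 0)).Local v), x * y = y * x := fun x y =>
    Prod.ext (Subtype.ext (mul_comm_of_mem_torusU_cmLocal_two L v x.1.2 y.1.2))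
      (Subtype.ext (Literature.NumberTheory.Rogawski1990.gl_fin_one_comm _ _))
  -- positivity of the orbital-form constant
  have hKco := isCompact_isOpen_cmLocalIntegralLevel L 2 (Matrix.of fun i j : Fin 2 => if i.val + j.val + 1 = 2 then (1 : L) else 0) v
  have hTS_open : IsOpen {t : ↥(cmBorelTriple L 2 v).M | (t : ↥(unitaryGroupOfForm (conjLocal L (IsCMField.complexConj L) v) (cmLocalForm L 2 v))) ∈ cmLocalIntegralLevel L 2 (Matrix.of fun i j : Fin 2 => if i.val + j.val + 1 = 2 then (1 : L) else 0) v} := hKco.2.preimage continuous_subtype_val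
  have hTS_cpt : IsCompact {t : ↥(cmBorelTriple L 2 v).M | (t : ↥(unitaryGroupOfForm (conjLocal L (IsCMField.complexConj L) v) (cmLocalForm L 2 v))) ∈ cmLocalIntegralLevel L 2 (Matrix.of fun i j : Fin 2 => if i.val + j.val + 1 = 2 then (1 : L) else 0) v} := hTcl.isClosedEmbedding_subtypeVal.isCompact_preimage hKco.1
  have hTS0 : μT {t : ↥(cmBorelTriple L 2 v).M | (t : ↥(unitaryGroupOfForm (conjLocal L (IsCMField.complexConj L) v) (cmLocalForm L 2 v))) ∈ cmLocalIntegralLevel L 2 (Matrix.of fun i j : Fin 2 => if i.val + j.val + 1 = 2 then (1 : L) else 0) v} ≠ 0 :=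
    hTS_open.measure_ne_zero μT ⟨1, by rw [Set.mem_setOf_eq, OneMemClass.coe_one]; exact (cmLocalIntegralLevel L 2 (Matrix.of fun i j : Fin 2 => if i.val + j.val + 1 = 2 then (1 : L) else 0) v).one_mem⟩
  have hTStop : μT {t : ↥(cmBorelTriple L 2 v).M | (t : ↥(unitaryGroupOfForm (conjLocal L (IsCMField.complexConj L) v) (cmLocalForm L 2 v))) ∈ cmLocalIntegralLevel L 2 (Matrix.of fun i j : Fin 2 => if i.val + j.val + 1 = 2 then (1 : L) else 0) v} ≠ ∞ := hTS_cpt.measure_lt_top.ne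
  have hK1univ : ((cmLocalIntegralLevel L 1 (Matrix.of fun i j : Fin 1 => if i.val + j.val + 1 = 1 then (1 : L) else 0) v : Subgroup ((cmDatum L 1 (Matrix.of fun i j : Fin 1 => if i.val + j.val + 1 = 1 then (1 : L) else 0)).Local v)) : Set ((cmDatum L 1 (Matrix.of fun i j : Fin 1 => if i.val + j.val + 1 = 1 then (1 : L) else 0)).Local v)) = Set.univ := Set.eq_univ_of_forall fun x => hK₁ x
  have hK1c := isCompact_isOpen_cmLocalIntegralLevel L 1 (Matrix.of fun i j : Fin 1 => if i.val + j.val + 1 = 1 then (1 : L) else 0) v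
  have h1univ0 : ν₁ Set.univ ≠ 0 := isOpen_univ.measure_ne_zero ν₁ Set.univ_nonempty
  have h1univtop : ν₁ Set.univ ≠ ∞ := by rw [← hK1univ]; exact hK1c.1.measure_lt_top.ne
  have hTpos : 0 < μT.real {t : ↥(cmBorelTriple L 2 v).M | (t : ↥(unitaryGroupOfForm (conjLocal L (IsCMField.complexConj L) v) (cmLocalForm L 2 v))) ∈ cmLocalIntegralLevel L 2 (Matrix.of fun i j : Fin 2 => if i.val + j.val + 1 = 2 then (1 : L) else 0) v} := ENNReal.toReal_pos hTS0 hTStop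
  have h1pos : 0 < ν₁.real Set.univ := ENNReal.toReal_pos h1univ0 h1univtop
  set m : ℝ := μT.real {t : ↥(cmBorelTriple L 2 v).M | (t : ↥(unitaryGroupOfForm (conjLocal L (IsCMField.complexConj L) v) (cmLocalForm L 2 v))) ∈ cmLocalIntegralLevel L 2 (Matrix.of fun i j : Fin 2 => if i.val + j.val + 1 = 2 then (1 : L) else 0) v} * ν₁.real Set.univ with hm
  have hmpos : 0 < m := mul_pos hTpos h1pos
  have hm0 : (m : ℂ) ≠ 0 := by exact_mod_cast hmpos.ne'
  -- the level `C = C₂ × K₁`: compact open; open subgroups are a basis at `1`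
  have hCo : IsOpen ((C₂.prod K₁ : Subgroup (↥(cmBorelTriple L 2 v).M × ((cmDatum L 1 (Matrix.of fun i j : Fin 1 => if i.val + j.val + 1 = 1 then (1 : L) else 0)).Local v))) : Set (↥(cmBorelTriple L 2 v).M × ((cmDatum L 1 (Matrix.of fun i j : Fin 1 => if i.val + j.val + 1 = 1 then (1 : L) else 0)).Local v))) := by
    rw [Subgroup.coe_prod]; exact hC₂o.prod hK₁o
  have hCc : IsCompact ((C₂.prod K₁ : Subgroup (↥(cmBorelTriple L 2 v).M × ((cmDatum L 1 (Matrix.of fun i j : Fin 1 => if i.val + j.val + 1 = 1 then (1 : L) else 0)).Local v))) : Set (↥(cmBorelTriple L 2 v).M × ((cmDatum L 1 (Matrix.of fun i j : Fin 1 => if i.val + j.val + 1 = 1 then (1 : L) else 0)).Local v))) := by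
    rw [Subgroup.coe_prod]; exact hC₂c.prod hK₁c
  have hbasis : ∀ V ∈ 𝓝 (1 : ↥(cmBorelTriple L 2 v).M × ((cmDatum L 1 (Matrix.of fun i j : Fin 1 => if i.val + j.val + 1 = 1 then (1 : L) else 0)).Local v)), ∃ C' : Subgroup (↥(cmBorelTriple L 2 v).M × ((cmDatum L 1 (Matrix.of fun i j : Fin 1 => if i.val + j.val + 1 = 1 then (1 : L) else 0)).Local v)), IsOpen (C' : Set (↥(cmBorelTriple L 2 v).M × ((cmDatum L 1 (Matrix.of fun i j : Fin 1 => if i.val + j.val + 1 = 1 then (1 : L) else 0)).Local v))) ∧ (C' : Set (↥(cmBorelTriple L 2 v).M × ((cmDatum L 1 (Matrix.of fun i j : Fin 1 => if i.val + j.val + 1 = 1 then (1 : L) else 0)).Local v))) ⊆ V :=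
    exists_isOpen_subgroup_subset_of_nonarchimedean_prod_subtype (cmBorelTriple L 2 v).M
  -- THE CHARACTER INTEGRALS OF `Ψ` (orbital form + F1-H + Fubini)
  have key : ∀ χ : ↥(cmBorelTriple L 2 v).M × ((cmDatum L 1 (Matrix.of fun i j : Fin 1 => if i.val + j.val + 1 = 1 then (1 : L) else 0)).Local v) →* ℂˣ, Continuous (fun x => ((χ x : ℂˣ) : ℂ)) → IsLocallyConstant χ → (∀ x, ‖((χ x : ℂˣ) : ℂ)‖ = 1) →
      ∫ x, ((χ x : ℂˣ) : ℂ) * Ψ x ∂(μT.prod ν₁) =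
        if ∀ c ∈ C₂.prod K₁, χ c = 1 then ((m : ℂ) * A) * (((χ (b₁, z₁) : ℂˣ) : ℂ) + κ * ((χ (b₂, z₁) : ℂˣ) : ℂ)) else 0 := by
    intro χ hχc hχlc _hχu
    -- the two restrictions
    set χ₂ : ↥(cmBorelTriple L 2 v).M →* ℂˣ := χ.comp (MonoidHom.inl ↥(cmBorelTriple L 2 v).M ((cmDatum L 1 (Matrix.of fun i j : Fin 1 => if i.val + j.val + 1 = 1 then (1 : L) else 0)).Local v)) with hχ₂def
    set χ₁ : ((cmDatum L 1 (Matrix.of fun i j : Fin 1 => if i.val + j.val + 1 = 1 then (1 : L) else 0)).Local v) →* ℂˣ := χ.comp (MonoidHom.inr ↥(cmBorelTriple L 2 v).M ((cmDatum L 1 (Matrix.of fun i j : Fin 1 => if i.val + j.val + 1 = 1 then (1 : L) else 0)).Local v)) with hχ₁def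
    have hsplit : ∀ (t : ↥(cmBorelTriple L 2 v).M) (u : ((cmDatum L 1 (Matrix.of fun i j : Fin 1 => if i.val + j.val + 1 = 1 then (1 : L) else 0)).Local v)), χ (t, u) = χ₂ t * χ₁ u := fun t u => map_prod_eq_mul_inl_inr χ t u
    have hχ₂c : Continuous fun t : ↥(cmBorelTriple L 2 v).M => ((χ₂ t : ℂˣ) : ℂ) :=
      hχc.comp (continuous_id.prodMk continuous_const)
    have hχ₁lc : IsLocallyConstant (χ₁ : ((cmDatum L 1 (Matrix.of fun i j : Fin 1 => if i.val + j.val + 1 = 1 then (1 : L) else 0)).Local v) → ℂˣ) := by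
      have : (χ₁ : ((cmDatum L 1 (Matrix.of fun i j : Fin 1 => if i.val + j.val + 1 = 1 then (1 : L) else 0)).Local v) → ℂˣ) = (χ : ↥(cmBorelTriple L 2 v).M × ((cmDatum L 1 (Matrix.of fun i j : Fin 1 => if i.val + j.val + 1 = 1 then (1 : L) else 0)).Local v) → ℂˣ) ∘ (fun u : ((cmDatum L 1 (Matrix.of fun i j : Fin 1 => if i.val + j.val + 1 = 1 then (1 : L) else 0)).Local v) => ((1 : ↥(cmBorelTriple L 2 v).M), u)) := by
        funext u; rfl
      rw [this]
      exact hχlc.comp_continuous (continuous_const.prodMk continuous_id)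
    have hχ₁o : IsOpen ((χ₁.ker : Subgroup ((cmDatum L 1 (Matrix.of fun i j : Fin 1 => if i.val + j.val + 1 = 1 then (1 : L) else 0)).Local v)) : Set ((cmDatum L 1 (Matrix.of fun i j : Fin 1 => if i.val + j.val + 1 = 1 then (1 : L) else 0)).Local v)) := by
      rw [MonoidHom.coe_ker]
      exact hχ₁lc.isOpen_fiber 1
    -- the orbital form, with `Φ t u := χ₂ t · χ₁ u · Ψ (t, u)`
    have horb := smoothTrace_cmPrincipalSeriesH_eq_inv_mul_integral L w hw νH hmH χ₂ hχ₂c χ₁ hχ₁o μT ν₁ hK₁ fH hfH hfHc hae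
      (fun t u => ((χ₂ t : ℂˣ) : ℂ) * ((χ₁ u : ℂˣ) : ℂ) * Ψ (t, u))
      (hΨ.mono fun t ht => ht.mono fun u hu => fun d hd hb hreg hP => by
        rw [hu d hd hb hreg hP]; ring)
    -- F1-H
    have hF1 := hF1H χ₂ hχ₂c χ₁ hχ₁o
    -- the iterated integral equals `m · (spectral side)`
    have hI : ∫ t, ∫ u, ((χ₂ t : ℂˣ) : ℂ) * ((χ₁ u : ℂˣ) : ℂ) * Ψ (t, u) ∂ν₁ ∂μT =
        (m : ℂ) * (if (∀ c ∈ C₂, χ₂ c = 1) ∧ (∀ k ∈ K₁, χ₁ k = 1)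
          then A * ((χ₁ z₁ : ℂˣ) : ℂ) * (((χ₂ b₁ : ℂˣ) : ℂ) + κ * ((χ₂ b₂ : ℂˣ) : ℂ)) else 0) := by
      have h := horb.symm.trans hF1
      rw [Complex.ofReal_inv] at h
      exact (inv_mul_eq_iff_eq_mul₀ hm0).1 h
    -- Fubini
    have hint : Integrable (fun x : ↥(cmBorelTriple L 2 v).M × ((cmDatum L 1 (Matrix.of fun i j : Fin 1 => if i.val + j.val + 1 = 1 then (1 : L) else 0)).Local v) => ((χ x : ℂˣ) : ℂ) * Ψ x) (μT.prod ν₁) :=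
      (hχc.mul hΨlc.continuous).integrable_of_hasCompactSupport hΨK.mul_left
    rw [integral_prod _ hint]
    have hfun : (fun t : ↥(cmBorelTriple L 2 v).M => ∫ u, ((χ (t, u) : ℂˣ) : ℂ) * Ψ (t, u) ∂ν₁) =
        fun t => ∫ u, ((χ₂ t : ℂˣ) : ℂ) * ((χ₁ u : ℂˣ) : ℂ) * Ψ (t, u) ∂ν₁ := by
      funext t
      refine integral_congr_ae (Filter.Eventually.of_forall fun u => ?_)
      simp only [hsplit t u, Units.val_mul]
    rw [hfun, hI]
    -- compare the two closed forms
    have hiff := forall_mem_prod_eq_one_iff χ C₂ K₁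
    by_cases hP : (∀ c ∈ C₂, χ₂ c = 1) ∧ (∀ k ∈ K₁, χ₁ k = 1)
    · rw [if_pos hP, if_pos (hiff.2 hP), hsplit b₁ z₁, hsplit b₂ z₁, Units.val_mul, Units.val_mul]
      ring
    · rw [if_neg hP, if_neg (fun h => hP (hiff.1 h)), mul_zero]
  -- ★ TWO-COSET FOURIER INVERSION on `T_H`
  have hmain := eq_twoCoset_of_forall_integral_char_mul_eq_of_comm (μT.prod ν₁) hcomm (C₂.prod K₁) hCo hCc hbasis hΨlc hΨK
    (b₁, z₁) (b₂, z₁) ((m : ℂ) * A) κ key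
  -- the measure of the level: `(μ_T ⊗ ν₁)(C₂ × K₁) = μ_T(C₂) · ν₁(K₁)`
  have hμC : (μT.prod ν₁).real ((C₂.prod K₁ : Subgroup (↥(cmBorelTriple L 2 v).M × ((cmDatum L 1 (Matrix.of fun i j : Fin 1 => if i.val + j.val + 1 = 1 then (1 : L) else 0)).Local v))) : Set (↥(cmBorelTriple L 2 v).M × ((cmDatum L 1 (Matrix.of fun i j : Fin 1 => if i.val + j.val + 1 = 1 then (1 : L) else 0)).Local v))) =
      μT.real (C₂ : Set ↥(cmBorelTriple L 2 v).M) * ν₁.real (K₁ : Set ((cmDatum L 1 (Matrix.of fun i j : Fin 1 => if i.val + j.val + 1 = 1 then (1 : L) else 0)).Local v)) := by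
    rw [measureReal_def, Subgroup.coe_prod, Measure.prod_prod, ENNReal.toReal_mul]
    rfl
  rw [hmain, hμC]
  funext x
  congr 1
  push_cast
  ring

set_option maxHeartbeats 3200000 in
set_option synthInstance.maxHeartbeats 400000 in
/-- **Pointwise reading of D3-ii-H at a good regular point.**  Same frame and hypotheses as `normalizedOrbitalIntegralH_eq_twoCoset`; at a point `(t, u)` with a diagonal
writing `t = diag(d)` (`d₀⁻¹d₁ − 1` a unit) where the version `Ψ` IS the normalised orbital integral (`hpt`, e.g. every regular `P_H`-good point of the producer's
local-constancy set), the canonical orbital integral itself is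
`O^{can}_{(t,u)}(f_H) = δ_{B₂}^{1∕2}(t)⁻¹ · J₂(t) · κ_H · (𝟙_{(b₁,z₁)(C₂×K₁)}(t,u) + κ·𝟙_{(b₂,z₁)(C₂×K₁)}(t,u))`, `κ_H = A · μ_T{t ∈ K_{2,v}} · ν₁(univ) ∕ (μ_T(C₂) · ν₁(K₁))`,
`J₂(t) = χ⁻(d₀⁻¹d₁)⁻¹`. [cite: Rogawski1990, §4.9 (4.9.4) p. 56; §12.7 Lemma 12.7.3 (proof) p. 195] [cite: HewittRoss1979, Thm. (23.11)] -/
theorem classOrbitalIntegralH_eq_twoCoset_apply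
    {v : HeightOneSpectrum (𝓞 ↥(maximalRealSubfield L))} (w : PlacesOver L v) (hw : IsCMField.complexConj L • w.1 = w.1)
    [mHH : MeasurableSpace (((cmDatum L 2 (Matrix.of fun i j : Fin 2 => if i.val + j.val + 1 = 2 then (1 : L) else 0)).Local v) × ((cmDatum L 1 (Matrix.of fun i j : Fin 1 => if i.val + j.val + 1 = 1 then (1 : L) else 0)).Local v))] [BorelSpace (((cmDatum L 2 (Matrix.of fun i j : Fin 2 => if i.val + j.val + 1 = 2 then (1 : L) else 0)).Local v) × ((cmDatum L 1 (Matrix.of fun i j : Fin 1 => if i.val + j.val + 1 = 1 then (1 : L) else 0)).Local v))]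
    [∀ a : (((cmDatum L 2 (Matrix.of fun i j : Fin 2 => if i.val + j.val + 1 = 2 then (1 : L) else 0)).Local v) × ((cmDatum L 1 (Matrix.of fun i j : Fin 1 => if i.val + j.val + 1 = 1 then (1 : L) else 0)).Local v)), MeasurableSpace ((((cmDatum L 2 (Matrix.of fun i j : Fin 2 => if i.val + j.val + 1 = 2 then (1 : L) else 0)).Local v) × ((cmDatum L 1 (Matrix.of fun i j : Fin 1 => if i.val + j.val + 1 = 1 then (1 : L) else 0)).Local v)) ⧸ Subgroup.centralizer ({a} : Set (((cmDatum L 2 (Matrix.of fun i j : Fin 2 => if i.val + j.val + 1 = 2 then (1 : L) else 0)).Local v) × ((cmDatum L 1 (Matrix.of fun i j : Fin 1 => if i.val + j.val + 1 = 1 then (1 : L) else 0)).Local v))))]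
    [∀ a : (((cmDatum L 2 (Matrix.of fun i j : Fin 2 => if i.val + j.val + 1 = 2 then (1 : L) else 0)).Local v) × ((cmDatum L 1 (Matrix.of fun i j : Fin 1 => if i.val + j.val + 1 = 1 then (1 : L) else 0)).Local v)), BorelSpace ((((cmDatum L 2 (Matrix.of fun i j : Fin 2 => if i.val + j.val + 1 = 2 then (1 : L) else 0)).Local v) × ((cmDatum L 1 (Matrix.of fun i j : Fin 1 => if i.val + j.val + 1 = 1 then (1 : L) else 0)).Local v)) ⧸ Subgroup.centralizer ({a} : Set (((cmDatum L 2 (Matrix.of fun i j : Fin 2 => if i.val + j.val + 1 = 2 then (1 : L) else 0)).Local v) × ((cmDatum L 1 (Matrix.of fun i j : Fin 1 => if i.val + j.val + 1 = 1 then (1 : L) else 0)).Local v))))]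
    (νH : Measure (((cmDatum L 2 (Matrix.of fun i j : Fin 2 => if i.val + j.val + 1 = 2 then (1 : L) else 0)).Local v) × ((cmDatum L 1 (Matrix.of fun i j : Fin 1 => if i.val + j.val + 1 = 1 then (1 : L) else 0)).Local v))) [νH.IsHaarMeasure] [νH.IsMulRightInvariant]
    {P_H : (((cmDatum L 2 (Matrix.of fun i j : Fin 2 => if i.val + j.val + 1 = 2 then (1 : L) else 0)).Local v) × ((cmDatum L 1 (Matrix.of fun i j : Fin 1 => if i.val + j.val + 1 = 1 then (1 : L) else 0)).Local v)) → Prop} {mH : OrbitalMeasureFamily (((cmDatum L 2 (Matrix.of fun i j : Fin 2 => if i.val + j.val + 1 = 2 then (1 : L) else 0)).Local v) × ((cmDatum L 1 (Matrix.of fun i j : Fin 1 => if i.val + j.val + 1 = 1 then (1 : L) else 0)).Local v))} (hmH : mH.IsCanonical P_H νH)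
    [MeasurableSpace ↥(unitaryGroupOfForm (conjLocal L (IsCMField.complexConj L) v) (cmLocalForm L 2 v))] [BorelSpace ↥(unitaryGroupOfForm (conjLocal L (IsCMField.complexConj L) v) (cmLocalForm L 2 v))] [MeasurableSpace ((cmDatum L 1 (Matrix.of fun i j : Fin 1 => if i.val + j.val + 1 = 1 then (1 : L) else 0)).Local v)] [BorelSpace ((cmDatum L 1 (Matrix.of fun i j : Fin 1 => if i.val + j.val + 1 = 1 then (1 : L) else 0)).Local v)]
    (μT : Measure ↥(cmBorelTriple L 2 v).M) [μT.IsHaarMeasure] (ν₁ : Measure ((cmDatum L 1 (Matrix.of fun i j : Fin 1 => if i.val + j.val + 1 = 1 then (1 : L) else 0)).Local v)) [ν₁.IsHaarMeasure]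
    (hK₁ : ∀ x : ((cmDatum L 1 (Matrix.of fun i j : Fin 1 => if i.val + j.val + 1 = 1 then (1 : L) else 0)).Local v), x ∈ cmLocalIntegralLevel L 1 (Matrix.of fun i j : Fin 1 => if i.val + j.val + 1 = 1 then (1 : L) else 0) v)
    (fH : (((cmDatum L 2 (Matrix.of fun i j : Fin 2 => if i.val + j.val + 1 = 2 then (1 : L) else 0)).Local v) × ((cmDatum L 1 (Matrix.of fun i j : Fin 1 => if i.val + j.val + 1 = 1 then (1 : L) else 0)).Local v)) → ℂ) (hfH : IsLocallyConstant fH) (hfHc : HasCompactSupport fH)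
    (hae : ∀ᵐ t : ↥(cmBorelTriple L 2 v).M ∂μT, ∀ᵐ u : ((cmDatum L 1 (Matrix.of fun i j : Fin 1 => if i.val + j.val + 1 = 1 then (1 : L) else 0)).Local v) ∂ν₁,
      IsRegularElt ((t : ↥(unitaryGroupOfForm (conjLocal L (IsCMField.complexConj L) v) (cmLocalForm L 2 v))) : GL (Fin 2) (LocalRing L v)) ∧ P_H (Quotient.out (ConjClasses.mk (((t : ↥(unitaryGroupOfForm (conjLocal L (IsCMField.complexConj L) v) (cmLocalForm L 2 v))) : ((cmDatum L 2 (Matrix.of fun i j : Fin 2 => if i.val + j.val + 1 = 2 then (1 : L) else 0)).Local v)), u))))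
    (C₂ : Subgroup ↥(cmBorelTriple L 2 v).M) (hC₂o : IsOpen (C₂ : Set ↥(cmBorelTriple L 2 v).M)) (hC₂c : IsCompact (C₂ : Set ↥(cmBorelTriple L 2 v).M))
    (K₁ : Subgroup ((cmDatum L 1 (Matrix.of fun i j : Fin 1 => if i.val + j.val + 1 = 1 then (1 : L) else 0)).Local v)) (hK₁o : IsOpen (K₁ : Set ((cmDatum L 1 (Matrix.of fun i j : Fin 1 => if i.val + j.val + 1 = 1 then (1 : L) else 0)).Local v))) (hK₁c : IsCompact (K₁ : Set ((cmDatum L 1 (Matrix.of fun i j : Fin 1 => if i.val + j.val + 1 = 1 then (1 : L) else 0)).Local v)))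
    (b₁ b₂ : ↥(cmBorelTriple L 2 v).M) (z₁ : ((cmDatum L 1 (Matrix.of fun i j : Fin 1 => if i.val + j.val + 1 = 1 then (1 : L) else 0)).Local v)) (A κ : ℂ)
    (hF1H : haveI := locallyCompactSpace_cmBorelU L 2 v
      ∀ (χ₂ : ↥(torusU (conjLocal L (IsCMField.complexConj L) v) (cmLocalForm L 2 v)) →* ℂˣ) (_hχ₂ : Continuous fun t => ((χ₂ t : ℂˣ) : ℂ))
        (χ₁ : ((cmDatum L 1 (Matrix.of fun i j : Fin 1 => if i.val + j.val + 1 = 1 then (1 : L) else 0)).Local v) →* ℂˣ) (_hχ₁ : IsOpen ((χ₁.ker : Subgroup ((cmDatum L 1 (Matrix.of fun i j : Fin 1 => if i.val + j.val + 1 = 1 then (1 : L) else 0)).Local v)) : Set ((cmDatum L 1 (Matrix.of fun i j : Fin 1 => if i.val + j.val + 1 = 1 then (1 : L) else 0)).Local v))),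
        (cmPrincipalSeriesH L v χ₂ χ₁).smoothTrace νH fH =
          if (∀ c ∈ C₂, χ₂ c = 1) ∧ (∀ k ∈ K₁, χ₁ k = 1)
          then A * ((χ₁ z₁ : ℂˣ) : ℂ) * (((χ₂ b₁ : ℂˣ) : ℂ) + κ * ((χ₂ b₂ : ℂˣ) : ℂ)) else 0)
    (Ψ : ↥(cmBorelTriple L 2 v).M × ((cmDatum L 1 (Matrix.of fun i j : Fin 1 => if i.val + j.val + 1 = 1 then (1 : L) else 0)).Local v) → ℂ) (hΨlc : IsLocallyConstant Ψ) (hΨK : HasCompactSupport Ψ)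
    (hΨ : haveI := locallyCompactSpace_cmBorelU L 2 v
      ∀ᵐ t : ↥(cmBorelTriple L 2 v).M ∂μT, ∀ᵐ u : ((cmDatum L 1 (Matrix.of fun i j : Fin 1 => if i.val + j.val + 1 = 1 then (1 : L) else 0)).Local v) ∂ν₁, ∀ (d : Fin 2 → (LocalRing L v)ˣ)
      (hd : glDiagonal 2 (LocalRing L v) d = ((t : ↥(unitaryGroupOfForm (conjLocal L (IsCMField.complexConj L) v) (cmLocalForm L 2 v))) : GL (Fin 2) (LocalRing L v)))
      (hb : IsUnit ((((d 0)⁻¹ * d 1 : (LocalRing L v)ˣ) : LocalRing L v) - 1)),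
      IsRegularElt ((t : ↥(unitaryGroupOfForm (conjLocal L (IsCMField.complexConj L) v) (cmLocalForm L 2 v))) : GL (Fin 2) (LocalRing L v)) → P_H (Quotient.out (ConjClasses.mk (((t : ↥(unitaryGroupOfForm (conjLocal L (IsCMField.complexConj L) v) (cmLocalForm L 2 v))) : ((cmDatum L 2 (Matrix.of fun i j : Fin 2 => if i.val + j.val + 1 = 2 then (1 : L) else 0)).Local v)), u))) →
      Ψ (t, u) =
          ((rootDeltaChar (cmBorelTriple L 2 v).P ⟨(t : ↥(unitaryGroupOfForm (conjLocal L (IsCMField.complexConj L) v) (cmLocalForm L 2 v))), (cmBorelTriple L 2 v).M_le t.2⟩ : ℂˣ) : ℂ) *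
        ((((letI : MeasurableSpace (LocalRing L v) := borel _; haveI : BorelSpace (LocalRing L v) := ⟨rfl⟩
          haveI : SecondCountableTopology (LocalRing L v) := secondCountableTopology_localRing (E := L) v
          ((skewModulus (conjLocal L (IsCMField.complexConj L) v) (continuous_conjLocal L (IsCMField.complexConj L) v) hb.unit
            (map_unit_torusScalar_sub_one_two (conjLocal L (IsCMField.complexConj L) v) (cmLocalForm_eq_over L 2 v)
              (⟨(t : ↥(unitaryGroupOfForm (conjLocal L (IsCMField.complexConj L) v) (cmLocalForm L 2 v))), t.2⟩ : ↥(torusU (conjLocal L (IsCMField.complexConj L) v) (cmLocalForm L 2 v))) hd hb))⁻¹ : ℝ≥0)) : ℝ) : ℂ))⁻¹ *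
        classOrbitalIntegral mH fH (ConjClasses.mk (((t : ↥(unitaryGroupOfForm (conjLocal L (IsCMField.complexConj L) v) (cmLocalForm L 2 v))) : ((cmDatum L 2 (Matrix.of fun i j : Fin 2 => if i.val + j.val + 1 = 2 then (1 : L) else 0)).Local v)), u)))
    -- the point and its diagonal writing
    (t : ↥(cmBorelTriple L 2 v).M) (u : ((cmDatum L 1 (Matrix.of fun i j : Fin 1 => if i.val + j.val + 1 = 1 then (1 : L) else 0)).Local v)) (d : Fin 2 → (LocalRing L v)ˣ)
    (hd : glDiagonal 2 (LocalRing L v) d = ((t : ↥(unitaryGroupOfForm (conjLocal L (IsCMField.complexConj L) v) (cmLocalForm L 2 v))) : GL (Fin 2) (LocalRing L v)))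
    (hb : IsUnit ((((d 0)⁻¹ * d 1 : (LocalRing L v)ˣ) : LocalRing L v) - 1))
    (hpt : haveI := locallyCompactSpace_cmBorelU L 2 v
      Ψ (t, u) =
          ((rootDeltaChar (cmBorelTriple L 2 v).P ⟨(t : ↥(unitaryGroupOfForm (conjLocal L (IsCMField.complexConj L) v) (cmLocalForm L 2 v))), (cmBorelTriple L 2 v).M_le t.2⟩ : ℂˣ) : ℂ) *
        ((((letI : MeasurableSpace (LocalRing L v) := borel _; haveI : BorelSpace (LocalRing L v) := ⟨rfl⟩
          haveI : SecondCountableTopology (LocalRing L v) := secondCountableTopology_localRing (E := L) v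
          ((skewModulus (conjLocal L (IsCMField.complexConj L) v) (continuous_conjLocal L (IsCMField.complexConj L) v) hb.unit
            (map_unit_torusScalar_sub_one_two (conjLocal L (IsCMField.complexConj L) v) (cmLocalForm_eq_over L 2 v)
              (⟨(t : ↥(unitaryGroupOfForm (conjLocal L (IsCMField.complexConj L) v) (cmLocalForm L 2 v))), t.2⟩ : ↥(torusU (conjLocal L (IsCMField.complexConj L) v) (cmLocalForm L 2 v))) hd hb))⁻¹ : ℝ≥0)) : ℝ) : ℂ))⁻¹ *
        classOrbitalIntegral mH fH (ConjClasses.mk (((t : ↥(unitaryGroupOfForm (conjLocal L (IsCMField.complexConj L) v) (cmLocalForm L 2 v))) : ((cmDatum L 2 (Matrix.of fun i j : Fin 2 => if i.val + j.val + 1 = 2 then (1 : L) else 0)).Local v)), u))) :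
    haveI := locallyCompactSpace_cmBorelU L 2 v
    classOrbitalIntegral mH fH (ConjClasses.mk (((t : ↥(unitaryGroupOfForm (conjLocal L (IsCMField.complexConj L) v) (cmLocalForm L 2 v))) : ((cmDatum L 2 (Matrix.of fun i j : Fin 2 => if i.val + j.val + 1 = 2 then (1 : L) else 0)).Local v)), u)) =
      ((rootDeltaChar (cmBorelTriple L 2 v).P ⟨(t : ↥(unitaryGroupOfForm (conjLocal L (IsCMField.complexConj L) v) (cmLocalForm L 2 v))), (cmBorelTriple L 2 v).M_le t.2⟩ : ℂˣ) : ℂ)⁻¹ *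
        (((letI : MeasurableSpace (LocalRing L v) := borel _; haveI : BorelSpace (LocalRing L v) := ⟨rfl⟩
          haveI : SecondCountableTopology (LocalRing L v) := secondCountableTopology_localRing (E := L) v
          ((skewModulus (conjLocal L (IsCMField.complexConj L) v) (continuous_conjLocal L (IsCMField.complexConj L) v) hb.unit
            (map_unit_torusScalar_sub_one_two (conjLocal L (IsCMField.complexConj L) v) (cmLocalForm_eq_over L 2 v)
              (⟨(t : ↥(unitaryGroupOfForm (conjLocal L (IsCMField.complexConj L) v) (cmLocalForm L 2 v))), t.2⟩ : ↥(torusU (conjLocal L (IsCMField.complexConj L) v) (cmLocalForm L 2 v))) hd hb))⁻¹ : ℝ≥0)) : ℝ) : ℂ) *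
      ((A * ((μT.real {t : ↥(cmBorelTriple L 2 v).M | (t : ↥(unitaryGroupOfForm (conjLocal L (IsCMField.complexConj L) v) (cmLocalForm L 2 v))) ∈ cmLocalIntegralLevel L 2 (Matrix.of fun i j : Fin 2 => if i.val + j.val + 1 = 2 then (1 : L) else 0) v} * ν₁.real Set.univ : ℝ) : ℂ)) /
          ((μT.real (C₂ : Set ↥(cmBorelTriple L 2 v).M) * ν₁.real (K₁ : Set ((cmDatum L 1 (Matrix.of fun i j : Fin 1 => if i.val + j.val + 1 = 1 then (1 : L) else 0)).Local v)) : ℝ) : ℂ) *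
        ({x : ↥(cmBorelTriple L 2 v).M × ((cmDatum L 1 (Matrix.of fun i j : Fin 1 => if i.val + j.val + 1 = 1 then (1 : L) else 0)).Local v) | (b₁, z₁)⁻¹ * x ∈ ((C₂.prod K₁ : Subgroup (↥(cmBorelTriple L 2 v).M × ((cmDatum L 1 (Matrix.of fun i j : Fin 1 => if i.val + j.val + 1 = 1 then (1 : L) else 0)).Local v))) : Set (↥(cmBorelTriple L 2 v).M × ((cmDatum L 1 (Matrix.of fun i j : Fin 1 => if i.val + j.val + 1 = 1 then (1 : L) else 0)).Local v)))}.indicator (fun _ => (1 : ℂ)) (t, u) +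
          κ * {x : ↥(cmBorelTriple L 2 v).M × ((cmDatum L 1 (Matrix.of fun i j : Fin 1 => if i.val + j.val + 1 = 1 then (1 : L) else 0)).Local v) | (b₂, z₁)⁻¹ * x ∈ ((C₂.prod K₁ : Subgroup (↥(cmBorelTriple L 2 v).M × ((cmDatum L 1 (Matrix.of fun i j : Fin 1 => if i.val + j.val + 1 = 1 then (1 : L) else 0)).Local v))) : Set (↥(cmBorelTriple L 2 v).M × ((cmDatum L 1 (Matrix.of fun i j : Fin 1 => if i.val + j.val + 1 = 1 then (1 : L) else 0)).Local v)))}.indicator (fun _ => (1 : ℂ)) (t, u))) := by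
  haveI := locallyCompactSpace_cmBorelU L 2 v
  have hmain := normalizedOrbitalIntegralH_eq_twoCoset L w hw νH hmH μT ν₁ hK₁ fH hfH hfHc hae C₂ hC₂o hC₂c K₁ hK₁o hK₁c b₁ b₂ z₁ A κ
    hF1H Ψ hΨlc hΨK hΨ
  -- `δ ≠ 0`, `J₂(t) ≠ 0`
  have hδ : ((rootDeltaChar (cmBorelTriple L 2 v).P ⟨(t : ↥(unitaryGroupOfForm (conjLocal L (IsCMField.complexConj L) v) (cmLocalForm L 2 v))), (cmBorelTriple L 2 v).M_le t.2⟩ : ℂˣ) : ℂ) ≠ 0 := Units.ne_zero _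
  have hJ : (((letI : MeasurableSpace (LocalRing L v) := borel _; haveI : BorelSpace (LocalRing L v) := ⟨rfl⟩
          haveI : SecondCountableTopology (LocalRing L v) := secondCountableTopology_localRing (E := L) v
          ((skewModulus (conjLocal L (IsCMField.complexConj L) v) (continuous_conjLocal L (IsCMField.complexConj L) v) hb.unit
            (map_unit_torusScalar_sub_one_two (conjLocal L (IsCMField.complexConj L) v) (cmLocalForm_eq_over L 2 v)
              (⟨(t : ↥(unitaryGroupOfForm (conjLocal L (IsCMField.complexConj L) v) (cmLocalForm L 2 v))), t.2⟩ : ↥(torusU (conjLocal L (IsCMField.complexConj L) v) (cmLocalForm L 2 v))) hd hb))⁻¹ : ℝ≥0)) : ℝ) : ℂ) ≠ 0 := by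
    letI : MeasurableSpace (LocalRing L v) := borel _
    haveI : BorelSpace (LocalRing L v) := ⟨rfl⟩
    haveI : SecondCountableTopology (LocalRing L v) := secondCountableTopology_localRing (E := L) v
    have h0 : ((skewModulus (conjLocal L (IsCMField.complexConj L) v) (continuous_conjLocal L (IsCMField.complexConj L) v) hb.unit
            (map_unit_torusScalar_sub_one_two (conjLocal L (IsCMField.complexConj L) v) (cmLocalForm_eq_over L 2 v)
              (⟨(t : ↥(unitaryGroupOfForm (conjLocal L (IsCMField.complexConj L) v) (cmLocalForm L 2 v))), t.2⟩ : ↥(torusU (conjLocal L (IsCMField.complexConj L) v) (cmLocalForm L 2 v))) hd hb))⁻¹ : ℝ≥0) ≠ 0 :=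
      inv_ne_zero (skewModulus_pos _ _ _ _).ne'
    exact_mod_cast NNReal.coe_ne_zero.2 h0
  -- name the three scalars and solve for the orbital integral
  set δ : ℂ := ((rootDeltaChar (cmBorelTriple L 2 v).P ⟨(t : ↥(unitaryGroupOfForm (conjLocal L (IsCMField.complexConj L) v) (cmLocalForm L 2 v))), (cmBorelTriple L 2 v).M_le t.2⟩ : ℂˣ) : ℂ) with hδdef
  set J : ℂ := (((letI : MeasurableSpace (LocalRing L v) := borel _; haveI : BorelSpace (LocalRing L v) := ⟨rfl⟩
          haveI : SecondCountableTopology (LocalRing L v) := secondCountableTopology_localRing (E := L) v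
          ((skewModulus (conjLocal L (IsCMField.complexConj L) v) (continuous_conjLocal L (IsCMField.complexConj L) v) hb.unit
            (map_unit_torusScalar_sub_one_two (conjLocal L (IsCMField.complexConj L) v) (cmLocalForm_eq_over L 2 v)
              (⟨(t : ↥(unitaryGroupOfForm (conjLocal L (IsCMField.complexConj L) v) (cmLocalForm L 2 v))), t.2⟩ : ↥(torusU (conjLocal L (IsCMField.complexConj L) v) (cmLocalForm L 2 v))) hd hb))⁻¹ : ℝ≥0)) : ℝ) : ℂ) with hJdef
  set O : ℂ := classOrbitalIntegral mH fH (ConjClasses.mk (((t : ↥(unitaryGroupOfForm (conjLocal L (IsCMField.complexConj L) v) (cmLocalForm L 2 v))) : ((cmDatum L 2 (Matrix.of fun i j : Fin 2 => if i.val + j.val + 1 = 2 then (1 : L) else 0)).Local v)), u)) with hOdef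
  have hΨtu : Ψ (t, u) = _ := congrFun hmain (t, u)
  beta_reduce at hΨtu
  rw [hpt] at hΨtu
  rw [← hΨtu, show δ⁻¹ * J * (δ * J⁻¹ * O) = (δ⁻¹ * δ) * (J * J⁻¹) * O by ring, inv_mul_cancel₀ hδ, mul_inv_cancel₀ hJ, one_mul, one_mul]

end CM

end Summit.HodgeConjecture.HodgeConjecture.Cruxes.H413.F0P3cStCharTSShellOrbitalH

end
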